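import Mathlib
import Summits.Ventures.PercRepro2.RowC1AvoidSigns

/-!
# The `b`-avoiding union anticorrelation: the bounds (S3) / (S6) and (S3) ⟹ (E1′)
(blind cell PercRepro2, p2 g29; proofs/P2-G29-E1.md §1 (g), §4)

With `Q = {a₁ ↮ a₂}`, `U = C₁ ∪ C₂`, `U′ = K ∪ K₁` (`o` joined to a root avoiding `b`) and
`o ∈ K₁` = `avoidConnEvent ends b a₁ o`:

  **(S3)**  `−Cov_μ(1[b ∈ U], 1[o ∈ U′]) ≤ μ(b ∈ C₁) · μ(o ∈ K₁)`,   **(S6)**  the same with `½ μ(b ∈ C₁) μ(o ∈ K₁)`,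

cleared by `P(Q)²` (`S3Cov`, `S6Cov`; the `b`-avoiding union anticorrelation can be positive — the
`b`-avoiding (U-PA) is false — and these bound it).  `s3_of_s6` is `S6Cov ⟹ S3Cov` and
**`e1avoid_of_s3`** is `S3Cov ⟹ E1Avoid` (for `a₂ ≠ b`): split `{b ∈ U}` into `{b ∈ C₂} ⊔ {b ∈ C₁}`
and `{o ∈ U′}` into `{o ∈ K} ⊔ {o ∈ K₁}` on `Q`, and use the mirror repulsion `bL_avoidK_repel`
(`P(Q, b ∈ C₁, o ∈ K) P(Q) ≤ P(Q, b ∈ C₁) P(Q, o ∈ K)`) on the one cross term; then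
`e1avoid_iff_cov`.  So (S6) ⟹ (S3) ⟹ (E1′) ⟹ (E1) ⟹ row 2′C1 in the kernel.  (S3) and (S6) are
CONJECTURES of the cell (descents n = 6–8: 224,304 and 126,168 restarts, 0 exact negatives; (S3) is
not 2-copy typed-positive at n = 6 — 24 negative coefficients — so they are of the TRI-COV class).
-/

namespace Summit.Ventures.PercRepro2

namespace RowC1

section Union

variable {V : Type*} {E : Type*} [Fintype E] [DecidableEq E] [Fintype V] [DecidableEq V]
  {R : Type*} [CommRing R] [LinearOrder R] [IsStrictOrderedRing R]

/-- **(S3)**, cleared by `P(Q)²`: `P(Q, b ∈ U) · P(Q, o ∈ U′) ≤ P(Q) · P(Q, b ∈ U, o ∈ U′) +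
P(Q, b ∈ C₁) · P(Q, o ∈ K₁)`.  A CONJECTURE (p2 g29). -/
def S3Cov (p : E → R) (ends : E → Sym2 V) (a₁ a₂ o b : V) : Prop :=
  prob p ((connEvent ends a₁ b ∪ connEvent ends a₂ b) ∩ (connEvent ends a₁ a₂)ᶜ) *
      prob p ((avoidConnEvent ends b a₁ o ∪ avoidConnEvent ends b a₂ o) ∩
        (connEvent ends a₁ a₂)ᶜ) ≤
    prob p (connEvent ends a₁ a₂)ᶜ *
        prob p ((connEvent ends a₁ b ∪ connEvent ends a₂ b) ∩
          (avoidConnEvent ends b a₁ o ∪ avoidConnEvent ends b a₂ o) ∩ (connEvent ends a₁ a₂)ᶜ) +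
      prob p (connEvent ends a₁ b ∩ (connEvent ends a₁ a₂)ᶜ) *
        prob p (avoidConnEvent ends b a₁ o ∩ (connEvent ends a₁ a₂)ᶜ)

/-- **(S6)**, cleared by `2 P(Q)²`: `2 P(Q, b ∈ U) · P(Q, o ∈ U′) ≤ 2 P(Q) · P(Q, b ∈ U, o ∈ U′) +
P(Q, b ∈ C₁) · P(Q, o ∈ K₁)`.  A CONJECTURE (p2 g29). -/
def S6Cov (p : E → R) (ends : E → Sym2 V) (a₁ a₂ o b : V) : Prop :=
  2 * (prob p ((connEvent ends a₁ b ∪ connEvent ends a₂ b) ∩ (connEvent ends a₁ a₂)ᶜ) *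
      prob p ((avoidConnEvent ends b a₁ o ∪ avoidConnEvent ends b a₂ o) ∩
        (connEvent ends a₁ a₂)ᶜ)) ≤
    2 * (prob p (connEvent ends a₁ a₂)ᶜ *
        prob p ((connEvent ends a₁ b ∪ connEvent ends a₂ b) ∩
          (avoidConnEvent ends b a₁ o ∪ avoidConnEvent ends b a₂ o) ∩ (connEvent ends a₁ a₂)ᶜ)) +
      prob p (connEvent ends a₁ b ∩ (connEvent ends a₁ a₂)ᶜ) *
        prob p (avoidConnEvent ends b a₁ o ∩ (connEvent ends a₁ a₂)ᶜ)

omit [Fintype V] [DecidableEq V] in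
/-- `(S6) ⟹ (S3)`. -/
theorem s3_of_s6 (p : E → R) (hp : IsProbVec p) (ends : E → Sym2 V) (a₁ a₂ o b : V)
    (h : S6Cov p ends a₁ a₂ o b) : S3Cov p ends a₁ a₂ o b := by
  unfold S6Cov at h
  unfold S3Cov
  have h0 : 0 ≤ prob p (connEvent ends a₁ b ∩ (connEvent ends a₁ a₂)ᶜ) *
      prob p (avoidConnEvent ends b a₁ o ∩ (connEvent ends a₁ a₂)ᶜ) :=
    mul_nonneg (prob_nonneg hp _) (prob_nonneg hp _)
  linarith

omit [Fintype E] [DecidableEq E] [Fintype V] [DecidableEq V] in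
/-- On `Q`, `{b ∈ C₁}` and `{b ∈ C₂}` are disjoint. -/
lemma disjoint_bL_bH (ends : E → Sym2 V) (a₁ a₂ b : V) (A : Set (Config E)) :
    Disjoint (connEvent ends a₁ b ∩ A ∩ (connEvent ends a₁ a₂)ᶜ)
      (connEvent ends a₂ b ∩ A ∩ (connEvent ends a₁ a₂)ᶜ) := by
  rw [Set.disjoint_left]
  rintro ω ⟨⟨h1, -⟩, hQ⟩ ⟨⟨h2, -⟩, -⟩
  exact hQ (conn_trans h1 (conn_symm h2))

omit [Fintype E] [DecidableEq E] [Fintype V] [DecidableEq V] in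
/-- On `Q`, `{o ∈ K₁}` and `{o ∈ K}` are disjoint. -/
lemma disjoint_oK1_oK (ends : E → Sym2 V) (a₁ a₂ o b : V) (A : Set (Config E)) :
    Disjoint (A ∩ avoidConnEvent ends b a₁ o ∩ (connEvent ends a₁ a₂)ᶜ)
      (A ∩ avoidConnEvent ends b a₂ o ∩ (connEvent ends a₁ a₂)ᶜ) := by
  rw [Set.disjoint_left]
  rintro ω ⟨⟨-, h1⟩, hQ⟩ ⟨⟨-, h2⟩, -⟩
  exact hQ (conn_trans (conn_of_avoidConn h1) (conn_symm (conn_of_avoidConn h2)))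

omit [Fintype V] [DecidableEq V] [LinearOrder R] [IsStrictOrderedRing R] in
/-- `P(Q, b ∈ U, A) = P(Q, b ∈ C₁, A) + P(Q, b ∈ C₂, A)`. -/
lemma prob_bU_split (p : E → R) (ends : E → Sym2 V) (a₁ a₂ b : V) (A : Set (Config E)) :
    prob p ((connEvent ends a₁ b ∪ connEvent ends a₂ b) ∩ A ∩ (connEvent ends a₁ a₂)ᶜ) =
      prob p (connEvent ends a₁ b ∩ A ∩ (connEvent ends a₁ a₂)ᶜ) +
        prob p (connEvent ends a₂ b ∩ A ∩ (connEvent ends a₁ a₂)ᶜ) := by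
  rw [Set.union_inter_distrib_right, Set.union_inter_distrib_right]
  exact prob_union_of_disjoint p (disjoint_bL_bH ends a₁ a₂ b A)

omit [Fintype V] [DecidableEq V] [LinearOrder R] [IsStrictOrderedRing R] in
/-- `P(A, o ∈ U′, Q) = P(A, o ∈ K₁, Q) + P(A, o ∈ K, Q)`. -/
lemma prob_oU'_split (p : E → R) (ends : E → Sym2 V) (a₁ a₂ o b : V) (A : Set (Config E)) :
    prob p (A ∩ (avoidConnEvent ends b a₁ o ∪ avoidConnEvent ends b a₂ o) ∩
        (connEvent ends a₁ a₂)ᶜ) =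
      prob p (A ∩ avoidConnEvent ends b a₁ o ∩ (connEvent ends a₁ a₂)ᶜ) +
        prob p (A ∩ avoidConnEvent ends b a₂ o ∩ (connEvent ends a₁ a₂)ᶜ) := by
  rw [Set.inter_union_distrib_left, Set.union_inter_distrib_right]
  exact prob_union_of_disjoint p (disjoint_oK1_oK ends a₁ a₂ o b A)

/-- **(S3) ⟹ (E1′)** for `a₂ ≠ b`: the bound on the union anticorrelation gives the sharpening
(E1′) through the mirror repulsion `bL_avoidK_repel`. -/
theorem e1avoid_of_s3 (p : E → R) (hp : IsProbVec p) (ends : E → Sym2 V) (a₁ a₂ o b : V)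
    (hne : a₂ ≠ b) (h : S3Cov p ends a₁ a₂ o b) : E1Avoid p ends a₁ a₂ o b := by
  rw [e1avoid_iff_cov]
  unfold S3Cov at h
  -- names
  set Q := (connEvent ends a₁ a₂)ᶜ with hQ
  set BL := connEvent ends a₁ b with hBL
  set BH := connEvent ends a₂ b with hBH
  set OK₁ := avoidConnEvent ends b a₁ o with hOK₁
  set OK := avoidConnEvent ends b a₂ o with hOK
  -- the splits
  have s1 := prob_bU_split p ends a₁ a₂ b Set.univ
  simp only [Set.inter_univ] at s1
  have s2 := prob_oU'_split p ends a₁ a₂ o b Set.univ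
  simp only [Set.univ_inter] at s2
  have s3 := prob_bU_split p ends a₁ a₂ b (OK₁ ∪ OK)
  have s4 := prob_oU'_split p ends a₁ a₂ o b BL
  have s5 := prob_oU'_split p ends a₁ a₂ o b BH
  rw [s1, s2, s3, s4, s5] at h
  -- the mirror repulsion on the cross term `b ∈ C₁, o ∈ K`
  have hrep := bL_avoidK_repel p hp ends a₁ a₂ o b hne
  -- the nonnegativity we need
  have h0 : 0 ≤ prob p Q := prob_nonneg hp _
  nlinarith [h, hrep, h0]

end Union

end RowC1

end Summit.Ventures.PercRepro2
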